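import Summits.ResolutionOfSingularities.ResolutionOfSingularities.Theorems.PurelyInseparableDim4ResConeCInfTransport
import Summits.ResolutionOfSingularities.ResolutionOfSingularities.Theorems.PurelyInseparableDim4ResConeCInfWindowLaws
import Summits.ResolutionOfSingularities.ResolutionOfSingularities.Theorems.PurelyInseparableDim4ResConeCInfUFlag
import Summits.ResolutionOfSingularities.ResolutionOfSingularities.Theorems.PurelyInseparableDim4TschirnhausStraighten
import Summits.ResolutionOfSingularities.ResolutionOfSingularities.Theorems.PurelyInseparableDim4ResConeLinearReframe
import HarnessLib
import HarnessLib.Audit.Tags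

/-!
# Purely inseparable four-folds — C∞ FRAME TOOLS: a re-framing with its translation formula, straight residual cones
# from readings and back, and the `u`-axis flag at the entry of a pure corner step (cell `res-dim4-pi`, K2(p) lane,
# slice B; C∞ assembly K24c L2b, frame half, part 1)

[OURS · counted 0 · cell `res-dim4-pi` · K2(p) lane holder res-dim4-p-12 g3 (design (iii)); C∞ assembly owner
res-dim4-p-3 g4.]  Nothing here proves K2(p)/K2(5), `NoIsolatedTrap 5 5` or resolution of singularities in dimension
≥ 4 / characteristic `p` — NOT proved.  AI kernel work, weaker than expert review.

Tools the frame half of the C∞ assembly (`…ResConeCInfFrameEntry`) composes: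
* §1 **`exists_reframed_chain_full`** — res-dim4-p-11 g3's `FrameChange.exists_isWitnessedChain_cleanTsch` dressed
  with the invariants of `exists_reframed_chain` (`r`, `exc`, `ord₀`, shade, cleanness, isolation, `x^r ∣ F`), the `e_G`
  of FILE E part 1b, AND the translation formula `b k = update (β k) f (β k f − (φ k)′(β k))` — which the assembly
  needs to kill the `u`-translation of the first step by the linear datum `ψ₀ = (β u)·x_κ` (`linear_datum_kills_translation`).
* §2 `resForm_eq_C_mul_X_pow_of_readings` — straight readings (`coeff_{r+4e_f} F = a`, the other residual degree-`4`
  readings `0`) give back `resForm s = a·x_f⁴`; `straight_of_resForm_eq` — then every vertex form `ℓ` of the package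
  (`resForm = a′·ℓ⁴`) is straight (`ℓ_i = 0`, `i ≠ f`; res-dim4-p-3 g3's `linearForm_off_eq_zero_four`); `three_ne_zero_five`.
* §3 **`cInf_entry_of_corner`** — ONE PURE CORNER STEP in a slot chart `κ` from a straight ISOLATED parent with the exact
  pair ledger to an isolated child of order `6` / `e_G = 3`: the child is straight again (`resForm = a·x_f⁴`, same
  `a`; F3 (i)(ii)), carries the exact pair ledger (F2a `ledger_step_zero` at every order), and BOTH carry the `u`-axis
  flag `V(0) = coeff_{r+λ+μ+3u} ≠ 0` (res-dim4-typ-1 g3's (D3) `cInf_uFlag_of_child'`).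

[cite: CossartJannsenSaito2020, Thm. 3.14, Lemma 13.2] [cite: Hauser2010, §§F–G]
bears_on: LADDER-RESOLUTION:D157-DOOR2 (res-dim4-pi · K2(p) slice B · C∞ frame tools).
Supports stmt-ResolutionOfSingularities-16155 (helper).
-/

set_option linter.dupNamespace false -- mandated namespace of this single-conjunct summit

noncomputable section

namespace Summit.ResolutionOfSingularities.ResolutionOfSingularities.Theorems.PIDim4

namespace ResCone

open MvPolynomial Finset FrameChange
open Literature.AlgebraicGeometry.Resolution
open Literature.AlgebraicGeometry.Resolution.CentreBlowup
open Literature.AlgebraicGeometry.Resolution.Hauser2010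
open Literature.AlgebraicGeometry.Resolution.HauserPerlega2019
open PointBlowup (translate)

variable {K : Type} [Field K]

/-! ## §1 A re-framing of a chain with its translation formula -/

section Chain

variable (p : ℕ) [hp : Fact p.Prime] [CharP K p] [DecidableEq K]

/-- **RE-FRAMING WITH THE TRANSLATION FORMULA** (FILE E `exists_isWitnessedChain_cleanTsch` + the invariants of
`exists_reframed_chain` + the `e_G` of part 1b): as `…CInfTransport.exists_reframed_chain_finrank`, and in addition the
data recursion `φ (k+1) = (φ k)⁺` and the translations `b k = update (β k) f (β k f − eval (β k) ((φ k)′))`,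
`(φ k)′ := chartTransform 1 univ (j k) (φ k)`. [OURS · bookkeeping] [cite: Hauser2010, §§F–G] -/
theorem exists_reframed_chain_full {c : ℕ → State K} {j : ℕ → Fin 4} {β : ℕ → Fin 4 → K} {f : Fin 4}
    (hw : FreeTail.IsWitnessedChain p c j β) (hclean : deletePthPowers p (c 0).F = (c 0).F)
    (hjf : ∀ k, j k ≠ f) (hr : (c 0).r f = 0) (he : f ∉ (c 0).exc)
    (hdiv : ∀ k, ∀ e ∈ (c k).F.support, (c k).r ≤ e)
    (hband : ∀ k, ∃ o : ℕ, ordZero (c k).F = o ∧ ¬ p ∣ o)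
    {φ₀ : MvPolynomial (Fin 4) K} (hφ : f ∉ φ₀.vars) (h0 : constantCoeff φ₀ = 0) :
    ∃ (φ : ℕ → MvPolynomial (Fin 4) K) (b : ℕ → Fin 4 → K) (c' : ℕ → State K),
      φ 0 = φ₀ ∧ (∀ k, f ∉ (φ k).vars ∧ constantCoeff (φ k) = 0) ∧
      (∀ k, b k = Function.update (β k) f
        (β k f - MvPolynomial.eval (β k) (chartTransform 1 Finset.univ (j k) (φ k)))) ∧
      (∀ k, c' k = ⟨deletePthPowers p (tsch f (φ k) (c k).F), (c k).r, (c k).exc⟩) ∧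
      FreeTail.IsWitnessedChain p c' j b ∧ (∀ k, Step0 p (c' k) (c' (k + 1))) ∧
      (∀ k i, i ≠ f → b k i = β k i) ∧
      (∀ k, (c' k).r = (c k).r ∧ (c' k).exc = (c k).exc ∧ ordZero (c' k).F = ordZero (c k).F ∧
        (c' k).shade = (c k).shade ∧ deletePthPowers p (c' k).F = (c' k).F ∧
        (IsIsolated p (c' k).F ↔ IsIsolated p (c k).F) ∧ (∀ e ∈ (c' k).F.support, (c' k).r ≤ e) ∧
        Module.finrank K (resVertex (c' k)) = Module.finrank K (resVertex (c k))) := by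
  obtain ⟨φ, b, hφ0, hadm, hb, -, hw'⟩ := exists_isWitnessedChain_cleanTsch p hw hclean hjf hr he hφ h0
  refine ⟨φ, b, fun k => ⟨deletePthPowers p (tsch f (φ k) (c k).F), (c k).r, (c k).exc⟩, hφ0, hadm, hb,
    fun k => rfl, hw', FrameChange.step0_of_isWitnessedChain hw', fun k i hi => ?_,
    fun k => ⟨rfl, rfl, ?_, ?_, ?_, ?_, ?_, ?_⟩⟩
  · rw [hb k, Function.update_of_ne hi]
  · exact ordZero_clean_tsch p (hadm k).1 (hadm k).2 (clean_of_isWitnessedChain p hw hclean k)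
  · exact shade_cleanTschState p (hadm k).1 (hadm k).2 (clean_of_isWitnessedChain p hw hclean k)
  · exact PointBlowup.deletePthPowers_deletePthPowers p _
  · exact isIsolated_clean_tsch_iff p (hadm k).1 (hadm k).2 _
  · exact forall_le_of_mem_support_clean_tsch p (free_of_isWitnessedChain hw hjf hr he k).1 (hdiv k)
  · obtain ⟨o, ho, hpo⟩ := hband k
    exact finrank_resVertex_cleanTschState p (hadm k).1 (hadm k).2 (free_of_isWitnessedChain hw hjf hr he k).1
      (hdiv k) ho hpo

end Chain

/-- **The linear datum `ψ₀ = t·x_κ` kills a translation `t` along the re-framed letter** (`κ ≠ u`): its chart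
derivative `(ψ₀)′ = chartTransform 1 univ κ ψ₀` is the constant `t`, so the re-framed translation
`β u − eval β (ψ₀)′` is `β u − t`. [folklore] -/
theorem eval_chartTransform_one_C_mul_X (κ : Fin 4) (t : K) (β : Fin 4 → K) :
    MvPolynomial.eval β (chartTransform 1 Finset.univ κ (C t * X κ : MvPolynomial (Fin 4) K)) = t := by
  rw [chartTransform_C_mul, chartTransform_one_X, if_pos rfl, mul_one, eval_C]

/-- The datum `t·x_κ` is admissible at a letter `u ≠ κ`: `x_u ∉ vars`, constant term `0`. [folklore] -/
theorem linear_datum_admissible {κ u : Fin 4} (hκu : κ ≠ u) (t : K) :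
    u ∉ (C t * X κ : MvPolynomial (Fin 4) K).vars ∧ constantCoeff (C t * X κ : MvPolynomial (Fin 4) K) = 0 := by
  classical
  refine ⟨fun h => ?_, by rw [map_mul, constantCoeff_X, mul_zero]⟩
  have h' := vars_mul (C t : MvPolynomial (Fin 4) K) (X κ) h
  rw [vars_C, Finset.empty_union, vars_X, Finset.mem_singleton] at h'
  exact hκu h'.symm

/-! ## §2 Straight residual cones: readings ⇄ `resForm = a·x_f⁴`; `3 ≠ 0` -/

/-- **Readings give back the straight cone**: `ord₀ F = 6`, `|r| = 2`, `coeff_{r+4e_f} F = a` and the other residual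
degree-`4` readings vanish ⇒ `resForm s = a·x_f⁴`. [OURS · bookkeeping] -/
theorem resForm_eq_C_mul_X_pow_of_readings {f : Fin 4} {s : State K} (ho : ordZero s.F = (6 : ℕ))
    (hrdeg : s.r.degree = 2) {a : K} (ha : coeff (s.r + Finsupp.single f 4) s.F = a)
    (hstraight : ∀ m : Fin 4 →₀ ℕ, m.degree = 4 → m ≠ Finsupp.single f 4 → coeff (s.r + m) s.F = 0) :
    resForm s = C a * X f ^ 4 := by
  classical
  have hhom := resForm_isHomogeneous (s := s) ho
  rw [hrdeg, show 6 - 2 = 4 from rfl] at hhom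
  ext m
  rw [X_pow_eq_monomial, C_mul_monomial, mul_one, coeff_monomial]
  by_cases hm : m.degree = 4
  · rw [coeff_resForm, NarrowApolarity.coeff_initialForm_of_degree_eq ho (by rw [map_add, hrdeg, hm])]
    by_cases hmf : m = Finsupp.single f 4
    · rw [hmf, if_pos rfl]; exact ha
    · rw [if_neg (Ne.symm hmf)]; exact hstraight m hm hmf
  · rw [if_neg (fun h => hm (by rw [← h, Finsupp.degree_single]))]
    by_contra hne
    exact hm (by have := hhom hne; rwa [weight_one_eq_degree] at this)

/-- **A straight residual cone makes every vertex form of the package straight**: if `resForm s = a′·(Σ ℓᵢ xᵢ)⁴` and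
also `= a·x_f⁴` with `a ≠ 0`, then `ℓ_i = 0` for `i ≠ f` (`4 ≠ 0` in characteristic `5`). [OURS · bookkeeping] -/
theorem straight_of_resForm_eq [CharP K 5] {f : Fin 4} {s : State K} {a a' : K} {ℓ : Fin 4 → K} (ha : a ≠ 0)
    (hform : resForm s = C a' * (∑ i, C (ℓ i) * X i) ^ 4) (hstr : resForm s = C a * X f ^ 4) :
    ∀ i, i ≠ f → ℓ i = 0 := by
  classical
  have h4 : (4 : K) ≠ 0 := by
    have h : ((4 : ℕ) : K) ≠ 0 := by
      rw [Ne, CharP.cast_eq_zero_iff K 5]; decide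
    exact_mod_cast h
  have heq : C a' * (∑ i, C (ℓ i) * X i) ^ 4 = C a * X f ^ 4 := by rw [← hform, hstr]
  refine linearForm_off_eq_zero_four (ℓ := ℓ) (c := a') f h4 ?_ ?_
  · rw [heq, X_pow_eq_monomial, C_mul_monomial, mul_one, coeff_monomial, if_pos rfl]; exact ha
  · intro i hi
    rw [heq, X_pow_eq_monomial, C_mul_monomial, mul_one, coeff_monomial, if_neg]
    intro h
    have := DFunLike.congr_fun h i
    rw [Finsupp.single_eq_of_ne hi, Finsupp.add_apply, Finsupp.single_eq_same, Finsupp.single_eq_of_ne hi] at this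
    omega

/-- `3 ≠ 0` in characteristic `5`. [folklore] -/
theorem three_ne_zero_five [CharP K 5] : (3 : K) ≠ 0 := by
  have h : ((3 : ℕ) : K) ≠ 0 := by
    rw [Ne, CharP.cast_eq_zero_iff K 5]; decide
  exact_mod_cast h

/-! ## §3 The entry of a pure corner step: straightness, exact ledger and the `u`-axis flag ride along -/

section Entry

variable [CharP K 5] [DecidableEq K]
variable {κ o u f : Fin 4} (hκo : κ ≠ o) (hκu : κ ≠ u) (hκf : κ ≠ f) (hou : o ≠ u) (hof : o ≠ f) (huf : u ≠ f)
include hκo hκu hκf hou hof huf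

/-- **ENTRY OF A PURE CORNER STEP** in a slot chart `κ` (`r = e_κ + e_o`): from a STRAIGHT parent (`resForm = a·x_f⁴`,
`a ≠ 0`, order `6`, `x^r ∣ F`) carrying the EXACT pair-ledger support form, to an ISOLATED child
`s′ = step 5 univ κ 0 s` of order `6` with `e_G = 3` and `x^{r′} ∣ F′`, `r′ = r`: the child is straight with the SAME
coefficient (F3 `cInf_legal_readings_of_corner` (i)(ii)), carries the exact pair ledger (F2a `ledger_step_zero`), and
parent and child carry the `u`-axis flag `coeff_{r + e_κ + e_o + 3e_u} ≠ 0` (typ-1 g3's (D3) `cInf_uFlag_of_child'`).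
[OURS] [cite: CossartJannsenSaito2020, Thm. 3.14, Lemma 13.2] -/
theorem cInf_entry_of_corner {s : State K} (hr : s.r = Finsupp.single κ 1 + Finsupp.single o 1)
    (hdiv : ∀ e ∈ s.F.support, s.r ≤ e) (ho : ordZero s.F = (6 : ℕ)) {a : K} (ha : a ≠ 0)
    (hform : resForm s = C a * X f ^ 4)
    (hled : ∀ e ∈ s.F.support, e f ≤ 3 → 2 ≤ e κ ∧ 2 ≤ e o)
    (hiso' : IsIsolated 5 (CentreBlowup.step 5 Finset.univ κ 0 s).F)
    (ho' : ordZero (CentreBlowup.step 5 Finset.univ κ 0 s).F = (6 : ℕ))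
    (he3' : Module.finrank K (resVertex (CentreBlowup.step 5 Finset.univ κ 0 s)) = 3)
    (hr' : (CentreBlowup.step 5 Finset.univ κ 0 s).r = Finsupp.single κ 1 + Finsupp.single o 1)
    (hdiv' : ∀ e ∈ (CentreBlowup.step 5 Finset.univ κ 0 s).F.support, (CentreBlowup.step 5 Finset.univ κ 0 s).r ≤ e) :
    resForm (CentreBlowup.step 5 Finset.univ κ 0 s) = C a * X f ^ 4 ∧
      (∀ e ∈ (CentreBlowup.step 5 Finset.univ κ 0 s).F.support, e f ≤ 3 → 2 ≤ e κ ∧ 2 ≤ e o) ∧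
      coeff (s.r + (Finsupp.single κ 1 + Finsupp.single o 1 + Finsupp.single u 3)) s.F ≠ 0 ∧
      coeff ((CentreBlowup.step 5 Finset.univ κ 0 s).r + (Finsupp.single κ 1 + Finsupp.single o 1 + Finsupp.single u 3))
        (CentreBlowup.step 5 Finset.univ κ 0 s).F ≠ 0 := by
  have hrdeg : s.r.degree = 2 := by rw [hr, map_add, Finsupp.degree_single, Finsupp.degree_single]
  have hrf : s.r f = 0 := by
    rw [hr, Finsupp.add_apply, Finsupp.single_eq_of_ne hκf.symm, Finsupp.single_eq_of_ne hof.symm, add_zero]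
  have hrdeg' : (CentreBlowup.step 5 Finset.univ κ 0 s).r.degree = 2 := by
    rw [hr', map_add, Finsupp.degree_single, Finsupp.degree_single]
  have hrf' : (CentreBlowup.step 5 Finset.univ κ 0 s).r f = 0 := by
    rw [hr', Finsupp.add_apply, Finsupp.single_eq_of_ne hκf.symm, Finsupp.single_eq_of_ne hof.symm, add_zero]
  obtain ⟨haread, hstraight⟩ := straight_readings_of_resForm ho hrdeg hform
  have htsch := tsch_row_of_ledger hκo hκf hof hr (fun d hd hdf => (hled d hd hdf).2)
  -- F3 (i)(ii): the child is straight with the same coefficient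
  obtain ⟨hstraight', ha', -⟩ := cInf_legal_readings_of_corner hκo hκf hof hr hdiv ho (by rw [haread]; exact ha)
    hstraight htsch ho' he3'
  have hform' : resForm (CentreBlowup.step 5 Finset.univ κ 0 s) = C a * X f ^ 4 := by
    refine resForm_eq_C_mul_X_pow_of_readings ho' hrdeg' ?_ ?_
    · rw [hr', ← hr, ha', haread]
    · intro m hm hne; rw [hr', ← hr]; exact hstraight' m hm hne
  -- F2a: the exact ledger rides
  have h7 := seven_le_degree_of_resForm ho hdiv hrdeg hrf hform
  have ho1 : ∀ d ∈ s.F.support, 1 ≤ d o := fun d hd => by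
    have h := hdiv d hd o
    rw [hr, Finsupp.add_apply, Finsupp.single_eq_of_ne (Ne.symm hκo), Finsupp.single_eq_same] at h
    omega
  have hled' : ∀ e ∈ (CentreBlowup.step 5 Finset.univ κ 0 s).F.support, e f ≤ 3 → 2 ≤ e κ ∧ 2 ≤ e o :=
    fun e he hef => ledger_step_zero hκo hκu hκf hou hof huf s ho1 h7 (N := e.degree + 5)
      (fun d hd hdf _ => hled d hd hdf) e he hef (by omega)
  -- (D3): the u-axis flag at parent and child
  have hκ1 : ∀ d ∈ s.F.support, 1 ≤ d κ := fun d hd => by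
    have h := hdiv d hd κ
    rw [hr, Finsupp.add_apply, Finsupp.single_eq_same, Finsupp.single_eq_of_ne hκo] at h
    omega
  have hr1' : ∀ d ∈ (CentreBlowup.step 5 Finset.univ κ 0 s).F.support, 1 ≤ d κ ∧ 1 ≤ d o := fun d hd => by
    have h1 := hdiv' d hd κ
    have h2 := hdiv' d hd o
    rw [hr', Finsupp.add_apply, Finsupp.single_eq_same, Finsupp.single_eq_of_ne hκo] at h1
    rw [hr', Finsupp.add_apply, Finsupp.single_eq_of_ne (Ne.symm hκo), Finsupp.single_eq_same] at h2
    exact ⟨by omega, by omega⟩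
  obtain ⟨hV, hV'⟩ := cInf_uFlag_of_child' hκo hκu hκf hou hof huf hr (by exact_mod_cast ho) hκ1
    (fun d hd hdf => (hled d hd hdf).1) hiso' hr1' hled' (le_degree_of_ordZero_eq ho')
    (straight_support_of_resForm ho' hdiv' hrdeg' hrf' hform')
  refine ⟨hform', hled', hV, ?_⟩
  have h := hV'
  rw [hr] at h
  rw [hr']
  exact h

end Entry

end ResCone

end Summit.ResolutionOfSingularities.ResolutionOfSingularities.Theorems.PIDim4

end
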